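/-
Copyright (c) 2026 the pub-hodgecm-mathlib formalisation cell (harness21).  Prover seat hodgecm-mathlib-K2E4-p11 (g10) on the S4 valve (dealer K2E2-plan (g8), S4-R77,
(TJ6) «HERBRAND WINDOW» FILE 2b; pen R90-C131-p02 (g2)): THE DOUBLING INDEX THROUGH THE CAYLEY CHART — `[c(M) : c(2M)] = [M : 2M]` for a window `M` on which the
chart is a twisted homomorphism `c X · c Y = c((X+Y)(1+XY)⁻¹)`, hypothesis-first over the chart letters of FILE 2a `R90S4CayleyWindowDoubling` (R90-C131-p04).
Crux H413 `stmt-HodgeConjecture-24833`, lane `--supports … --as helper` (count-neutral).  THEOREMS ONLY (no `def`, no `instance`, no notation, no named-fact hypothesis, no `sorry`).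
-/
import Mathlib.GroupTheory.Index
import Mathlib.LinearAlgebra.Matrix.NonsingularInverse
import HarnessLib

/-!
# R90-TF · S4 (Ch. 13.1–2) · road (J̃♭) «TWISTED TUBE JACOBIAN», (TJ6) HERBRAND WINDOW, FILE 2b: THE DOUBLING INDEX THROUGH THE CAYLEY CHART

Dealt by the S4 dealer K2E2-plan (g8) (S4-R77, 2026-09-05T03:30:15Z: FILE 2 split 2a∕2b; pen R90-C131-p02 (g2), `CENSUS-TJ6.md` §1 (c3)).  Seat K2E4-p11 (g10).
THE POINT.  In the Herbrand-window identity `(♮)` of the twisted Weyl integration formula [Rogawski1990, §12.5 p. 186] the analytic input is the equality of the SQUARING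
indices `[K_W : K_W²] = [F_W : F_W²]` of the two eigen-windows (p02's census §1 (b)(c)); in the Cayley chart `K_W = c(M⁺)`, `F_W = c(M⁻)`, and on a COMMUTING window
the chart is a twisted homomorphism `c X · c Y = c(X ⊕ Y)`, `X ⊕ Y = (X + Y)(1 + XY)⁻¹` (★ C2 `cayley_mul_cayley_eq_cayley` + commutativity, FILE 2a), with
`c(M)² = c(2M)` (ψ-Newton, FILE 2a).  THIS FILE converts the multiplicative index into the additive one: **`[H : H₂] = [M : M₂]`** whenever `H = c(M)`, `H₂ = c(M₂)`,
`M₂ ≤ M`, and the unit `1 + XY` (`X, Y ∈ M`) acts on `M₂` — NO depth hypothesis, no topology, no valuation: the map `X ↦ ⟦c X⟧ : M → H ⧸ H₂` satisfies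
`⟦c X⟧ = ⟦c Y⟧ ⟺ (c X)⁻¹ c Y = c((−X + Y)(1 − XY)⁻¹) ∈ c(M₂) ⟺ (−X + Y)(1 − XY)⁻¹ ∈ M₂ ⟺ −X + Y ∈ M₂ ⟺ ⟦X⟧ = ⟦Y⟧` (injectivity of `c` on `M`, ⊕-closure, the
unit action), so it descends to a bijection `M ⧸ M₂ ≃ H ⧸ H₂` and `Nat.card` agrees.  All chart facts enter as LETTERS, discharged by FILE 2a at the window
`M := M k`, `M₂ := 2·M k` (and `H₂ = c(M)²` by FILE 2a's `sq_image_cayley_window`); FILE 3a (p02) then feeds ★ FILE 1 `relIndex_range_eq_of_relIndex_sq_eq`.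

HONEST LABEL: HC_CM is proved only modulo the 7 printed citations (2 remaining named inputs: hLiu418 = `stmt-HodgeConjecture-24832`, h413 = `stmt-HodgeConjecture-24833`)
until rung 0 closes; this file closes no organ ((J̃♭) stays OPEN: it is a letter of the [H-♮] row); count-neutral helper.

## References
* [Rogawski1990] J. Rogawski, *Automorphic Representations of Unitary Groups in Three Variables*, Ann. of Math. Stud. 123 (1990), §12.5 p. 186 (twisted Weyl integration
  formula; the Herbrand window of the ε-stable torus).
* [Serre1979] J.-P. Serre, *Local Fields*, GTM 67 (1979), Ch. VIII §4 (Herbrand quotient of a cyclic group acting on a module).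
* [PlatonovRapinchuk1994] V. Platonov, A. Rapinchuk, *Algebraic Groups and Number Theory* (1994), §3.3 (Cayley chart on congruence windows).
-/

set_option autoImplicit false
set_option linter.dupNamespace false

open Set

namespace Summit.HodgeConjecture.HodgeConjecture.R90.S4

variable {K : Type*} [Field K] {n : Type*} [Fintype n] [DecidableEq n] {G : Type*} [Group G]

/-- **The coset criterion through the chart.**  For a window `M` on which the chart `c` is a twisted homomorphism (`hoplus`), compatible with inversion (`hneg`),
⊕-closed (`hwin`) and injective (`hinj`), and a subgroup `M₂ ≤ M` on which the units `1 + XY` (`X, Y ∈ M`) act (`hstab`, `hdet`): for `X, Y ∈ M`,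
`(c X)⁻¹ · c Y ∈ c(M₂) ⟺ −X + Y ∈ M₂`. [cite: PlatonovRapinchuk1994, §3.3] [cite: Rogawski1990, §12.5 p. 186] -/
theorem inv_mul_mem_image_iff_of_cayleyWindow (c : Matrix n n K → G) (M M2 : AddSubgroup (Matrix n n K)) (hM2M : M2 ≤ M)
    (hoplus : ∀ X ∈ M, ∀ Y ∈ M, c X * c Y = c ((X + Y) * (1 + X * Y)⁻¹))
    (hneg : ∀ X ∈ M, c (-X) = (c X)⁻¹)
    (hwin : ∀ X ∈ M, ∀ Y ∈ M, (X + Y) * (1 + X * Y)⁻¹ ∈ M)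
    (hinj : Set.InjOn c (M : Set (Matrix n n K)))
    (hdet : ∀ X ∈ M, ∀ Y ∈ M, IsUnit (1 + X * Y).det)
    (hstab : ∀ X ∈ M, ∀ Y ∈ M, ∀ Z ∈ M2, Z * (1 + X * Y)⁻¹ ∈ M2 ∧ Z * (1 + X * Y) ∈ M2)
    {X Y : Matrix n n K} (hX : X ∈ M) (hY : Y ∈ M) :
    (c X)⁻¹ * c Y ∈ c '' (M2 : Set (Matrix n n K)) ↔ -X + Y ∈ M2 := by
  have hnX : -X ∈ M := M.neg_mem hX
  -- `(c X)⁻¹ c Y = c w`, `w = (−X + Y)(1 + (−X)Y)⁻¹ ∈ M`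
  set w : Matrix n n K := (-X + Y) * (1 + -X * Y)⁻¹ with hwdef
  have hw : w ∈ M := hwin _ hnX _ hY
  have hcw : (c X)⁻¹ * c Y = c w := by rw [← hneg X hX, hoplus _ hnX _ hY]
  rw [hcw]
  constructor
  · rintro ⟨Z, hZ, hZw⟩
    -- `c Z = c w` with `Z, w ∈ M` ⇒ `Z = w` ⇒ `w ∈ M₂` ⇒ `−X + Y = w (1 + (−X) Y) ∈ M₂`
    have hZeq : Z = w := hinj (hM2M hZ) hw hZw
    have hw2 : w ∈ M2 := hZeq ▸ hZ
    have hback : w * (1 + -X * Y) = -X + Y := by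
      rw [hwdef, Matrix.mul_assoc, Matrix.nonsing_inv_mul _ (hdet _ hnX _ hY), Matrix.mul_one]
    rw [← hback]
    exact (hstab _ hnX _ hY _ hw2).2
  · intro hXY
    exact ⟨w, (hstab _ hnX _ hY _ hXY).1, rfl⟩

/-- **THE DOUBLING INDEX THROUGH THE CAYLEY CHART: `[H : H₂] = [M : M₂]`.**  Let `c` be a chart which on the window `M` (an additive subgroup of `M_n(K)`) is a twisted
homomorphism `c X · c Y = c((X + Y)(1 + XY)⁻¹)` with `c(−X) = (c X)⁻¹`, `M` ⊕-closed, `c` injective on `M`; let `M₂ ≤ M` be stable under the units `1 + XY` and their inverses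
(`X, Y ∈ M`); and let `H = c(M)`, `H₂ = c(M₂)` be subgroups of `G` (given by membership letters).  Then the relative indices agree: `H₂.relIndex H = M₂.relIndex M` — the map
`X ↦ ⟦c X⟧` descends to a bijection `M ⧸ M₂ ≃ H ⧸ H₂` (`inv_mul_mem_image_iff_of_cayleyWindow` is exactly «same coset ⟺ same coset»).  At the datum: `M = M_k` a Cayley window of
the commuting torus algebra, `M₂ = 2M_k`, `H₂ = c(M_k)² = c(2M_k)` (FILE 2a), giving `[c(M) : c(M)²] = [M : 2M]` for the Herbrand-window identity.
[cite: Rogawski1990, §12.5 p. 186] [cite: Serre1979, Ch. VIII §4] [cite: PlatonovRapinchuk1994, §3.3] -/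
theorem relIndex_image_eq_relIndex_of_cayleyWindow (c : Matrix n n K → G) (M M2 : AddSubgroup (Matrix n n K)) (hM2M : M2 ≤ M)
    (hoplus : ∀ X ∈ M, ∀ Y ∈ M, c X * c Y = c ((X + Y) * (1 + X * Y)⁻¹))
    (hneg : ∀ X ∈ M, c (-X) = (c X)⁻¹)
    (hwin : ∀ X ∈ M, ∀ Y ∈ M, (X + Y) * (1 + X * Y)⁻¹ ∈ M)
    (hinj : Set.InjOn c (M : Set (Matrix n n K)))
    (hdet : ∀ X ∈ M, ∀ Y ∈ M, IsUnit (1 + X * Y).det)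
    (hstab : ∀ X ∈ M, ∀ Y ∈ M, ∀ Z ∈ M2, Z * (1 + X * Y)⁻¹ ∈ M2 ∧ Z * (1 + X * Y) ∈ M2)
    (H H₂ : Subgroup G) (hH : ∀ g, g ∈ H ↔ g ∈ c '' (M : Set (Matrix n n K))) (hH₂ : ∀ g, g ∈ H₂ ↔ g ∈ c '' (M2 : Set (Matrix n n K))) :
    H₂.relIndex H = M2.relIndex M := by
  classical
  -- the chart lands in `H` on the window
  have hcH : ∀ X : ↥M, c X ∈ H := fun X => (hH _).2 ⟨X, X.2, rfl⟩
  -- the map to the multiplicative quotient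
  let f : ↥M → ↥H ⧸ H₂.subgroupOf H := fun X => QuotientGroup.mk ⟨c X, hcH X⟩
  -- same coset ⟺ same coset
  have key : ∀ X Y : ↥M, f X = f Y ↔ -X + Y ∈ M2.addSubgroupOf M := by
    intro X Y
    rw [AddSubgroup.mem_addSubgroupOf, QuotientGroup.eq, Subgroup.mem_subgroupOf]
    show ((⟨c X, hcH X⟩ : ↥H)⁻¹ * ⟨c Y, hcH Y⟩ : ↥H).1 ∈ H₂ ↔ ((-X + Y : ↥M) : Matrix n n K) ∈ M2
    rw [Subgroup.coe_mul, InvMemClass.coe_inv, AddSubgroup.coe_add, AddSubgroup.coe_neg, hH₂]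
    exact inv_mul_mem_image_iff_of_cayleyWindow c M M2 hM2M hoplus hneg hwin hinj hdet hstab X.2 Y.2
  -- descend to the additive quotient
  let g : ↥M ⧸ M2.addSubgroupOf M → ↥H ⧸ H₂.subgroupOf H :=
    Quotient.lift f fun X Y hXY => (key X Y).2 (QuotientAddGroup.leftRel_apply.mp hXY)
  have hg : ∀ X : ↥M, g (QuotientAddGroup.mk X) = f X := fun X => rfl
  have hginj : Function.Injective g := by
    intro q₁ q₂
    induction q₁ using QuotientAddGroup.induction_on with
    | H X =>
      induction q₂ using QuotientAddGroup.induction_on with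
      | H Y =>
        intro h
        rw [hg, hg] at h
        exact QuotientAddGroup.eq.2 ((key X Y).1 h)
  have hgsurj : Function.Surjective g := by
    intro q
    induction q using QuotientGroup.induction_on with
    | H h =>
      obtain ⟨X, hX, hXh⟩ := (hH _).1 h.2
      refine ⟨QuotientAddGroup.mk ⟨X, hX⟩, ?_⟩
      rw [hg]
      show (QuotientGroup.mk (⟨c X, hcH ⟨X, hX⟩⟩ : ↥H) : ↥H ⧸ H₂.subgroupOf H) = QuotientGroup.mk h
      congr 1
      exact Subtype.ext hXh
  -- count
  calc H₂.relIndex H = (H₂.subgroupOf H).index := rfl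
    _ = Nat.card (↥H ⧸ H₂.subgroupOf H) := Subgroup.index_eq_card _
    _ = Nat.card (↥M ⧸ M2.addSubgroupOf M) := (Nat.card_congr (Equiv.ofBijective g ⟨hginj, hgsurj⟩)).symm
    _ = (M2.addSubgroupOf M).index := (AddSubgroup.index_eq_card _).symm
    _ = M2.relIndex M := rfl

end Summit.HodgeConjecture.HodgeConjecture.R90.S4
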